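import Summits.ResolutionOfSingularities.ResolutionOfSingularities.Theses.EquisingularLift
import Summits.ResolutionOfSingularities.ResolutionOfSingularities.Theorems.WeightedThesis.Negative.LoadBearing
import Literature.AlgebraicGeometry.Resolution.KollarBlowupSequenceFunctorsProofs
import Literature.AlgebraicGeometry.Resolution.NonReducedNoResolution
import Literature.AlgebraicGeometry.Resolution.AbsoluteIntegralClosureNoResolution
import Literature.AlgebraicGeometry.Motives.VarietiesProperProofs

/-!
# `HypersurfacesSuffice` — negative lemmas: load-bearing hypotheses of the consequent

Support (negative) lemmas for crux `stmt-ResolutionOfSingularities-15964`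
(`Summit.ResolutionOfSingularities.ResolutionOfSingularities.Theses.EquisingularLift.HypersurfacesSuffice`,
shared verbatim with route `TeissierJung`): over an algebraically closed field `k`, resolution of
every integral closed hypersurface `H ⊆ ℙᵐ_k` with locally principal ideal (the (∀ (m : ℕ) (H : Scheme.{0}) (ι' : H ⟶ (projectiveSpace m k).left), IsClosedImmersion ι' →
        IsIntegral H →
        (∀ y : (projectiveSpace m k).left, ∃ U : (projectiveSpace m k).left.affineOpens,
          y ∈ (U : (projectiveSpace m k).left.Opens) ∧ (ι'.ker.ideal U).IsPrincipal) →
        Scheme.HasResolution H)CEDENT)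
implies resolution of every reduced separated `k`-scheme of finite type (the CONSEQUENT). Filed by
the standing disprover (cdisprove gen 1; work file `Cruxes/HypersurfacesSuffice/Disproof.lean`,
where the crux itself is moreover PROVED, §6). This file declares NO definition; the antecedent
and every dropped-hypothesis variant are written out inline.

What makes unconditional negative lemmas possible for an implication between two statements that
are both open in characteristic `p`: the antecedent is a THEOREM in characteristic `0` — Hironaka's
theorem is proved in the tree (`Hironaka1964_holds`) and `ℙᵐ_k → Spec k` is proper
(`isProper_projectiveSpace`) — so a dropped hypothesis of the consequent is tested at `k = ℚ̄`.

* `antecedent_of_charZero` — the antecedent holds over every field of characteristic `0`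
  (non-vacuity of the crux).
* `hypersurfacesSuffice_without_isReduced_iff` / `hypersurfacesSuffice_false_without_isReduced` —
  with `IsReduced X` dropped from the consequent, the crux is equivalent to "the antecedent fails
  over EVERY algebraically closed field" (witness `Spec k[ε]`,
  `not_hasResolution_spec_dualNumber`), hence FALSE (at `ℚ̄`).
* `hypersurfacesSuffice_without_locallyOfFiniteType_iff` /
  `hypersurfacesSuffice_false_without_locallyOfFiniteType` — the same with `LocallyOfFiniteType f`
  dropped (witness `Spec k[X]⁺`, the absolute integral closure of `k[X]`: the tree's
  `𝔽_p`-witness of `AbsoluteIntegralClosureNoResolution.lean` re-proved over an ARBITRARY field,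
  `aic_algebraMap_injective`, `aic_exists_sq_eq`, `aic_exists_prime_not_mem`,
  `not_hasResolution_spec_aic`).
* `hypersurfacesSuffice_strengthening_isRegular_false` — the strengthening "the consequent gives
  `X` REGULAR" is false (at `ℚ̄`, the cuspidal cubic; `WeightedThesis.Negative.not_isRegular_spec_cusp`).

## Sources
* H. Hironaka, Ann. of Math. 79 (1964), Main Theorem I — in the tree as `Hironaka1964_holds`
  (via Kollár 2007, Ch. 3).
* R. Hartshorne, *Algebraic Geometry* (1977), II Thm. 4.9 (`ℙⁿ` is proper).
* H. Matsumura, *Commutative Ring Theory* (1986), Thm. 14.3 (regular local rings are domains),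
  Thm. 19.4 (regular ⇒ normal). Folklore witnesses; the Stacks Project, Tags 01RN, 02IS, 00FZ.
-/

noncomputable section

open CategoryTheory AlgebraicGeometry TopologicalSpace
open Literature.AlgebraicGeometry.Resolution Literature.AlgebraicGeometry.Motives

set_option linter.dupNamespace false

namespace Summit.ResolutionOfSingularities.ResolutionOfSingularities.Theorems.HypersurfacesSuffice.Negative

/-! ## The antecedent holds in characteristic zero -/

/-- **Over a field of characteristic `0` every integral closed hypersurface of `ℙᵐ_k` (indeed
every reduced separated `k`-scheme of finite type) has a resolution**: Hironaka's theorem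
(`Hironaka1964_holds`) at the structure morphism `H ↪ ℙᵐ_k → Spec k`, which is separated, of
finite type and quasi-compact since `ℙᵐ_k → Spec k` is proper. [cite: Hironaka1964, Main Theorem I] -/
theorem antecedent_of_charZero (k : Type) [Field k] [CharZero k] :
    ∀ (m : ℕ) (H : Scheme.{0}) (ι' : H ⟶ (projectiveSpace m k).left), IsClosedImmersion ι' →
      IsIntegral H →
      (∀ y : (projectiveSpace m k).left, ∃ U : (projectiveSpace m k).left.affineOpens,
        y ∈ (U : (projectiveSpace m k).left.Opens) ∧ (ι'.ker.ideal U).IsPrincipal) →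
      Scheme.HasResolution H := by
  intro m H ι' hι' hH _
  haveI := hι'
  haveI := hH
  haveI : CharP k 0 := CharP.ofCharZero k
  haveI : IsProper (projectiveSpace m k).hom := isProper_projectiveSpace m k
  exact Hironaka1964_holds k H (ι' ≫ (projectiveSpace m k).hom) inferInstance inferInstance
    inferInstance inferInstance

/-! ## `IsReduced X` is load-bearing -/

/-- **With `IsReduced X` dropped from the consequent, the crux says exactly that its antecedent
fails over every algebraically closed field**: the weakened consequent is false at
`Spec k[ε] → Spec k` (affine, of finite type; `not_hasResolution_spec_dualNumber`) for every `k`.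
[folklore] -/
theorem hypersurfacesSuffice_without_isReduced_iff :
    (∀ (k : Type) [Field k] [IsAlgClosed k],
      (∀ (m : ℕ) (H : Scheme.{0}) (ι' : H ⟶ (projectiveSpace m k).left), IsClosedImmersion ι' →
        IsIntegral H →
        (∀ y : (projectiveSpace m k).left, ∃ U : (projectiveSpace m k).left.affineOpens,
          y ∈ (U : (projectiveSpace m k).left.Opens) ∧ (ι'.ker.ideal U).IsPrincipal) →
        Scheme.HasResolution H) →
      ∀ (X : Scheme.{0}) (f : X ⟶ Spec (.of k)), IsSeparated f → LocallyOfFiniteType f →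
        QuasiCompact f → Scheme.HasResolution X) ↔
    ∀ (k : Type) [Field k] [IsAlgClosed k], ¬ (∀ (m : ℕ) (H : Scheme.{0}) (ι' : H ⟶ (projectiveSpace m k).left), IsClosedImmersion ι' →
        IsIntegral H →
        (∀ y : (projectiveSpace m k).left, ∃ U : (projectiveSpace m k).left.affineOpens,
          y ∈ (U : (projectiveSpace m k).left.Opens) ∧ (ι'.ker.ideal U).IsPrincipal) →
        Scheme.HasResolution H) := by
  constructor
  · intro h k _ _ hk
    haveI : Module.Finite k (DualNumber k) := inferInstanceAs (Module.Finite k (k × k))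
    haveI : LocallyOfFiniteType (Spec.map (CommRingCat.ofHom (algebraMap k (DualNumber k)))) :=
      (HasRingHomProperty.Spec_iff (P := @LocallyOfFiniteType)).mpr
        (RingHom.finiteType_algebraMap.mpr inferInstance)
    exact not_hasResolution_spec_dualNumber k
      (h k hk (Spec (.of (DualNumber k)))
        (Spec.map (CommRingCat.ofHom (algebraMap k (DualNumber k))))
        inferInstance inferInstance inferInstance)
  · intro h k _ _ hk
    exact absurd hk (h k)

/-- **`IsReduced X` is load-bearing: the crux with it dropped is FALSE** — at `k = ℚ̄` the
antecedent holds (`antecedent_of_charZero`) and `Spec ℚ̄[ε]` has no resolution. [folklore] -/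
theorem hypersurfacesSuffice_false_without_isReduced :
    ¬ ∀ (k : Type) [Field k] [IsAlgClosed k],
      (∀ (m : ℕ) (H : Scheme.{0}) (ι' : H ⟶ (projectiveSpace m k).left), IsClosedImmersion ι' →
        IsIntegral H →
        (∀ y : (projectiveSpace m k).left, ∃ U : (projectiveSpace m k).left.affineOpens,
          y ∈ (U : (projectiveSpace m k).left.Opens) ∧ (ι'.ker.ideal U).IsPrincipal) →
        Scheme.HasResolution H) →
      ∀ (X : Scheme.{0}) (f : X ⟶ Spec (.of k)), IsSeparated f → LocallyOfFiniteType f →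
        QuasiCompact f → Scheme.HasResolution X := by
  rw [hypersurfacesSuffice_without_isReduced_iff]
  exact fun h => h (AlgebraicClosure ℚ) (antecedent_of_charZero (AlgebraicClosure ℚ))

/-! ## `LocallyOfFiniteType f` is load-bearing: the absolute integral closure of `K[X]`

The tree's witness `Spec 𝔽_p[X]⁺` (`AbsoluteIntegralClosureNoResolution.lean`) is written over
`ZMod p`; its proof is field-generic and is repeated here over an ARBITRARY field `K` (needed at
`K = ℚ̄`). No definition is introduced: the ring is `↥(integralClosure K[X] (AlgebraicClosure (RatFunc K)))`. -/

section AbsoluteIntegralClosure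

open Polynomial

variable (K : Type) [Field K]

/-- `K[X] → K[X]⁺` is injective. [folklore] -/
theorem aic_algebraMap_injective :
    Function.Injective (algebraMap K[X]
      ↥(integralClosure K[X] (AlgebraicClosure (RatFunc K)))) := by
  have h : Function.Injective (algebraMap K[X] (AlgebraicClosure (RatFunc K))) := by
    rw [IsScalarTower.algebraMap_eq K[X] (RatFunc K) (AlgebraicClosure (RatFunc K))]
    exact (algebraMap (RatFunc K) _).injective.comp (RatFunc.algebraMap_injective K)
  intro a b hab
  apply h
  have := congrArg
    (fun x : ↥(integralClosure K[X] (AlgebraicClosure (RatFunc K))) =>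
      (x : AlgebraicClosure (RatFunc K))) hab
  simpa using this

/-- Every element of `K[X]⁺` is a square. [folklore] -/
theorem aic_exists_sq_eq (a : ↥(integralClosure K[X] (AlgebraicClosure (RatFunc K)))) :
    ∃ b : ↥(integralClosure K[X] (AlgebraicClosure (RatFunc K))), b ^ 2 = a := by
  obtain ⟨z, hz⟩ := IsAlgClosed.exists_pow_nat_eq (a : AlgebraicClosure (RatFunc K)) two_pos
  have hzint : IsIntegral K[X] z := IsIntegral.of_pow two_pos (by rw [hz]; exact a.2)
  exact ⟨⟨z, hzint⟩, Subtype.ext hz⟩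

/-- Every non-zero `f ∈ K[X]⁺` avoids some non-zero prime (lying over an irreducible factor of
`c·X + 1`, `c ≠ 0` the constant term of an integral equation of `f`). [folklore] -/
theorem aic_exists_prime_not_mem
    (f : ↥(integralClosure K[X] (AlgebraicClosure (RatFunc K)))) (hf : f ≠ 0) :
    ∃ Q : Ideal ↥(integralClosure K[X] (AlgebraicClosure (RatFunc K))),
      Q.IsPrime ∧ Q ≠ ⊥ ∧ f ∉ Q := by
  have hinj := aic_algebraMap_injective K
  obtain ⟨P, hPm, hPf⟩ := (integralClosure.isIntegral f : IsIntegral K[X] f)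
  obtain ⟨P', hP, hXP'⟩ := P.exists_eq_pow_rootMultiplicity_mul_and_not_dvd hPm.ne_zero 0
  simp only [map_zero, sub_zero] at hP hXP'
  set c := P'.coeff 0 with hc_def
  have hc : c ≠ 0 := fun h0 => hXP' (Polynomial.X_dvd_iff.mpr h0)
  have hP'f : Polynomial.aeval f P' = 0 := by
    have h1 : Polynomial.aeval f P = 0 := hPf
    rw [hP, map_mul, map_pow, Polynomial.aeval_X] at h1
    exact (mul_eq_zero.mp h1).resolve_left (pow_ne_zero _ hf)
  have hrel : algebraMap K[X] _ c = -(Polynomial.aeval f P'.divX * f) := by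
    have h1 := hP'f
    rw [← Polynomial.divX_mul_X_add P', map_add, map_mul, Polynomial.aeval_X,
      Polynomial.aeval_C] at h1
    linear_combination h1
  have hdeg : (c * X + 1 : K[X]).natDegree = c.natDegree + 1 := by
    rw [Polynomial.natDegree_add_eq_left_of_natDegree_lt] <;>
      rw [Polynomial.natDegree_mul_X hc]
    simp
  have hne : (c * X + 1 : K[X]) ≠ 0 := by
    intro h0; rw [h0] at hdeg; simp at hdeg
  have hnu : ¬ IsUnit (c * X + 1 : K[X]) := by
    intro hu
    have := Polynomial.natDegree_eq_zero_of_isUnit hu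
    omega
  obtain ⟨π, hπirr, hπdvd⟩ := WfDvdMonoid.exists_irreducible_factor hnu hne
  have hπc : ¬ π ∣ c := by
    intro hdc
    apply hπirr.not_isUnit
    have : π ∣ (c * X + 1) - c * X := dvd_sub hπdvd (dvd_mul_of_dvd_left hdc _)
    exact isUnit_of_dvd_one (by simpa using this)
  let 𝔭 : Ideal K[X] := Ideal.span {π}
  haveI h𝔭 : 𝔭.IsPrime := (Ideal.span_singleton_prime hπirr.ne_zero).mpr hπirr.prime
  obtain ⟨Q, -, hQ, hQcomap⟩ := Ideal.exists_ideal_over_prime_of_isIntegral 𝔭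
    (⊥ : Ideal ↥(integralClosure K[X] (AlgebraicClosure (RatFunc K))))
    (by
      intro a ha
      have ha0 : algebraMap K[X]
          ↥(integralClosure K[X] (AlgebraicClosure (RatFunc K))) a = 0 :=
        Ideal.mem_bot.mp (Ideal.mem_comap.mp ha)
      have : a = 0 := hinj (by rw [ha0, map_zero])
      rw [this]; exact 𝔭.zero_mem)
  refine ⟨Q, hQ, ?_, ?_⟩
  · rintro rfl
    have hπmem : π ∈ (⊥ : Ideal ↥(integralClosure K[X]
        (AlgebraicClosure (RatFunc K)))).comap (algebraMap K[X] _) := by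
      rw [hQcomap]; exact Ideal.mem_span_singleton_self π
    have hπ0 : algebraMap K[X]
        ↥(integralClosure K[X] (AlgebraicClosure (RatFunc K))) π = 0 :=
      Ideal.mem_bot.mp (Ideal.mem_comap.mp hπmem)
    exact hπirr.ne_zero (hinj (by rw [hπ0, map_zero]))
  · intro hfQ
    have h1 : algebraMap K[X] _ c ∈ Q := by
      rw [hrel]; exact Q.neg_mem (Q.mul_mem_left _ hfQ)
    have h2 : c ∈ 𝔭 := by rw [← hQcomap]; exact h1
    exact hπc (Ideal.mem_span_singleton.mp h2)

/-- **`Spec K[X]⁺` has no resolution of singularities**, for every field `K`. [folklore] -/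
theorem not_hasResolution_spec_aic :
    ¬ Scheme.HasResolution (Spec (.of ↥(integralClosure K[X] (AlgebraicClosure (RatFunc K))))) :=
  not_hasResolution_spec_of_forall_exists_pow_eq _ le_rfl (aic_exists_sq_eq K)
    (aic_exists_prime_not_mem K)

end AbsoluteIntegralClosure

/-- **With `LocallyOfFiniteType f` dropped from the consequent, the crux again says that its
antecedent fails over every algebraically closed field**: the weakened consequent is false at
`Spec k[X]⁺ → Spec k` (affine, reduced; `not_hasResolution_spec_aic`). [folklore] -/
theorem hypersurfacesSuffice_without_locallyOfFiniteType_iff :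
    (∀ (k : Type) [Field k] [IsAlgClosed k],
      (∀ (m : ℕ) (H : Scheme.{0}) (ι' : H ⟶ (projectiveSpace m k).left), IsClosedImmersion ι' →
        IsIntegral H →
        (∀ y : (projectiveSpace m k).left, ∃ U : (projectiveSpace m k).left.affineOpens,
          y ∈ (U : (projectiveSpace m k).left.Opens) ∧ (ι'.ker.ideal U).IsPrincipal) →
        Scheme.HasResolution H) →
      ∀ (X : Scheme.{0}) (f : X ⟶ Spec (.of k)), IsSeparated f → QuasiCompact f →
        IsReduced X → Scheme.HasResolution X) ↔
    ∀ (k : Type) [Field k] [IsAlgClosed k], ¬ (∀ (m : ℕ) (H : Scheme.{0}) (ι' : H ⟶ (projectiveSpace m k).left), IsClosedImmersion ι' →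
        IsIntegral H →
        (∀ y : (projectiveSpace m k).left, ∃ U : (projectiveSpace m k).left.affineOpens,
          y ∈ (U : (projectiveSpace m k).left.Opens) ∧ (ι'.ker.ideal U).IsPrincipal) →
        Scheme.HasResolution H) := by
  constructor
  · intro h k _ _ hk
    let f : Spec (.of ↥(integralClosure (Polynomial k) (AlgebraicClosure (RatFunc k)))) ⟶
        Spec (.of k) :=
      Spec.map (CommRingCat.ofHom ((algebraMap (Polynomial k)
        ↥(integralClosure (Polynomial k) (AlgebraicClosure (RatFunc k)))).comp Polynomial.C))
    exact not_hasResolution_spec_aic k (h k hk _ f inferInstance inferInstance inferInstance)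
  · intro h k _ _ hk
    exact absurd hk (h k)

/-- **`LocallyOfFiniteType f` is load-bearing: the crux with it dropped is FALSE** — at `k = ℚ̄`,
`X = Spec ℚ̄[X]⁺`. [folklore] -/
theorem hypersurfacesSuffice_false_without_locallyOfFiniteType :
    ¬ ∀ (k : Type) [Field k] [IsAlgClosed k],
      (∀ (m : ℕ) (H : Scheme.{0}) (ι' : H ⟶ (projectiveSpace m k).left), IsClosedImmersion ι' →
        IsIntegral H →
        (∀ y : (projectiveSpace m k).left, ∃ U : (projectiveSpace m k).left.affineOpens,
          y ∈ (U : (projectiveSpace m k).left.Opens) ∧ (ι'.ker.ideal U).IsPrincipal) →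
        Scheme.HasResolution H) →
      ∀ (X : Scheme.{0}) (f : X ⟶ Spec (.of k)), IsSeparated f → QuasiCompact f →
        IsReduced X → Scheme.HasResolution X := by
  rw [hypersurfacesSuffice_without_locallyOfFiniteType_iff]
  exact fun h => h (AlgebraicClosure ℚ) (antecedent_of_charZero (AlgebraicClosure ℚ))

/-! ## The identity is not a resolution -/

/-- **Strengthening of `HypersurfacesSuffice` refuted: the consequent cannot be sharpened to
"`X` is regular"** — at `k = ℚ̄` the antecedent holds and the cuspidal cubic `Spec ℚ̄[T², T³]`
(affine, of finite type, reduced) is not regular (`WeightedThesis.Negative.not_isRegular_spec_cusp`).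
So the crux has content already in dimension one. [folklore] -/
theorem hypersurfacesSuffice_strengthening_isRegular_false :
    ¬ ∀ (k : Type) [Field k] [IsAlgClosed k],
      (∀ (m : ℕ) (H : Scheme.{0}) (ι' : H ⟶ (projectiveSpace m k).left), IsClosedImmersion ι' →
        IsIntegral H →
        (∀ y : (projectiveSpace m k).left, ∃ U : (projectiveSpace m k).left.affineOpens,
          y ∈ (U : (projectiveSpace m k).left.Opens) ∧ (ι'.ker.ideal U).IsPrincipal) →
        Scheme.HasResolution H) →
      ∀ (X : Scheme.{0}) (f : X ⟶ Spec (.of k)), IsSeparated f → LocallyOfFiniteType f →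
        QuasiCompact f → IsReduced X → Scheme.IsRegular X := by
  classical
  intro h
  let K := AlgebraicClosure ℚ
  let A : Subalgebra K (Polynomial K) :=
    Algebra.adjoin K ({Polynomial.X ^ 2, Polynomial.X ^ 3} : Set (Polynomial K))
  haveI : Algebra.FiniteType K ↥A := by
    refine ⟨(Subalgebra.fg_top A).mpr ⟨{Polynomial.X ^ 2, Polynomial.X ^ 3}, ?_⟩⟩
    simp [A]
  let f : Spec (.of ↥A) ⟶ Spec (.of K) := Spec.map (CommRingCat.ofHom (algebraMap K ↥A))
  haveI : LocallyOfFiniteType f :=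
    (HasRingHomProperty.Spec_iff (P := @LocallyOfFiniteType)).mpr
      (RingHom.finiteType_algebraMap.mpr inferInstance)
  exact WeightedThesis.Negative.not_isRegular_spec_cusp K
    (h K (antecedent_of_charZero K) (Spec (.of ↥A)) f inferInstance inferInstance inferInstance
      inferInstance)

end Summit.ResolutionOfSingularities.ResolutionOfSingularities.Theorems.HypersurfacesSuffice.Negative

end
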